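import Summits.NavierStokesRegularity.NavierStokesRegularity.Theorems.DssFarFieldSlavingBlowupTypeIDssProfileCorotatingProfileHypotheses
import Summits.NavierStokesRegularity.NavierStokesRegularity.Theorems.DssFarFieldSlavingBlowupTypeIDssProfileTwistNormalForm
import Literature.Analysis.FluidPDE.PineauVicolProfileTimeDerivativeDecay
import Literature.Analysis.FluidPDE.PineauVicolPressurePointwiseDecay
import Literature.Analysis.FluidPDE.TypeIAncientMildDecay
import HarnessLib

/-!
# Pineau–Vicol's (8.2) and Proposition 8.3 (8.6) for the co-rotating profile of a Type-I
  rotated-DSS field — the CLASS-LEVEL instantiation (route `DssFarFieldSlaving`, crux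
  `BlowupTypeIDssProfile`, stmt-NavierStokesRegularity-0155 — SUPPORT; cell pub-ns-dss, brick "B4c"
  of the (8.2) programme, pre-registration R-108 (i)–(vi))

HONEST FRAMING. A DECAY ESTIMATE (and the printed smallness statement it feeds) for the
`s`-derivative of the co-rotating similarity profile of a HYPOTHETICAL object: a Type-I ancient mild
field `V` (KNSS gauge, space–time Type-I bound, constant `M`) with a rotated `c`-DSS structure
`IsRotatedDSS c (rotZLIE (−θ)) V`, `1 < c` (Pineau–Vicol's twist convention; `α = θ/(2 log c)`,
period `S = 2 log c`). Nothing is excluded here, no census cell is touched, and nothing in this file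
bears on Navier–Stokes regularity or blow-up. Nothing is numeric.

THE OBJECTS (as in `…CorotatingProfileHypotheses.lean`). The co-rotating profile
`U(y, s) = R_{−αs} (lerayOrbit V s)(R_{αs} y)` (`R_θ = rotZ θ`), given pointwise (`hUys`), and the
transported Calderón–Zygmund pressure `P(y, s) = e^{−s} Q[V(−e^{−s})](e^{−s/2} R_{αs} y)`,
`Q = pressurePotential`.

WHAT IS PROVED, tree lemma by tree lemma.
* `typeI_corotatingProfile_pressure_eq` — R-108 (iv): the transported pressure IS the
  Calderón–Zygmund pressure of the co-rotating slice, `P(·, s) = Q[U(·, s)]` EXACTLY (Navier–Stokes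
  scaling of `Q`, `exp_mul_pressurePotential_eq`, and the `O(3)`-covariance
  `Q[L⁻¹ v L] = Q[v] ∘ L`, `TwistNormalForm.pressurePotential_conj_symm`), so the co-rotating profile
  equation of `typeI_rdss_corotatingProfile_hypotheses` is (1.14a) with `∇Q[U(s)]` verbatim.
* `typeI_corotatingProfile_decay83` — R-108 (iii): (8.3) for the co-rotating slices with ONE
  constant `K = K(M, N)` for all orders `j ≤ N`, uniformly in `s`
  (`(1+|y|)^{j+1} ‖Dʲ_y U(·,s)(y)‖ ≤ K`): the class theorem
  `IsTypeIAncientMild.exists_forall_le_pow_mul_norm_iteratedFDeriv_lerayOrbit_of_hasTypeIDecay`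
  (Pineau–Vicol Lemma 7.1 (7.2) with one constant up to order `N`, tree) transported through the rotation conjugation
  (Literature `norm_iteratedFDeriv_rotZ_conj`, slice smoothness `GaussianGap.contDiff_lerayOrbit_slice_of_typeI`).
* `typeI_rdss_corotatingProfile_timeDeriv_decay` — **(8.2) on the class**: one `Cs = Cs(M) ≥ 0`
  with `|∂ₛU(y,s)| ≤ Cs (2 log c)(1+|α|)²/(1+|y|)` and `|∇_y∂ₛU(y,s)| ≤ Cs (2 log c)(1+|α|)²/(1+|y|)²`
  for every member; R-108 (i) joint `C^∞` and (ii) exact two-sided `2 log c`-periodicity come from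
  the hypotheses package, and the Literature theorem for abstract jointly smooth periodic families
  in the summit-side convention (`PineauVicol2026.exists_norm_timeDeriv_le_of_periodic` /
  `exists_norm_fderiv_timeDeriv_le_of_periodic`, orders `≤ 7`) is applied to `U`.
* `typeI_rdss_corotatingProfile_prop_8_3` — **Proposition 8.3 (8.6) at the class level**: for
  every `ε > 0` there are `A ≥ 1`, `δ > 0` (depending on `M`, `ε` only) such that every member with
  `A ≤ |α|` and `(2 log c)(1+|α|)² ≤ δ` has `|α| ‖𝓡U(·,s)‖_{L²(G)} ≤ ε` on every slice — the tree's
  `pineauVicol_prop_8_3''` with its (8.2) hypothesis now discharged. This is a SMALLNESS statement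
  about the rotation defect `𝓡U = JU − D_yU[Jy]`, not an exclusion; the corner it belongs to
  (Theorem 1.7 (ii)) is class-covered separately by `rdssClass_pineauVicol_fast`.

R-108 (v): the twist is the `e₃`-axis proper rotation `rotZLIE (−θ)` throughout.

## References

* B. Pineau, V. Vicol, *On rotated backwards self-similar solutions of the incompressible 3D
  Navier–Stokes equations*, arXiv:2607.09619 (2026): (1.13)–(1.14a) (p. 7), Lemma 7.1 (7.2)
  (p. 24), Lemma 8.1 (8.2)–(8.3) and Proposition 8.3 (8.6) (p. 28). [PineauVicol2026]
* G. Koch, N. Nadirashvili, G. Seregin, V. Šverák, Acta Math. 203 (2009), §4, §6.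
  [KochNadirashviliSereginSverak2009]
-/

noncomputable section

set_option linter.dupNamespace false
-- nested operator types `ℝ³ →L[ℝ] ℝ³ →L[ℝ] ℝ³`
set_option maxSynthPendingDepth 3

namespace Summit.NavierStokesRegularity.NavierStokesRegularity.Theorems.GaussianHeadPressure

open Set Function Filter MeasureTheory InnerProductSpace Metric
open scoped RealInnerProductSpace Laplacian ContDiff Topology BigOperators
open Literature.Analysis Literature.Analysis.FluidPDE Literature.Analysis.FluidPDE.PineauVicol2026
open Summit.NavierStokesRegularity.NavierStokesRegularity.Theorems
open Summit.NavierStokesRegularity.NavierStokesRegularity.Theorems.TwistNormalForm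
  (pressurePotential_conj_symm)

/-! ### (8.3) on the class with one constant up to a given order -/

/-- **(8.3) for the co-rotating slices, ONE constant over the orders `j ≤ N`, uniformly in `s`
(R-108 (iii)).** For every `N` and every Type-I constant `M` there is `K = K(N, M) ≥ 0` such that
the co-rotating profile `U(y,s) = R_{−αs}(lerayOrbit V s)(R_{αs} y)` of EVERY `V` with
`IsTypeIAncientMild M V`, `HasTypeIDecay M V` and every angular speed `α` obeys
`(1+|y|)^{j+1} ‖Dʲ_y U(·, s)(y)‖ ≤ K` for all `j ≤ N`, `s`, `y`: the class bound transported through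
the rotation conjugation (`norm_iteratedFDeriv_rotZ_conj`: `‖Dʲ(R_θ f R_φ)(y)‖ = ‖Dʲ f(R_φ y)‖`, `|R_φ y| = |y|`;
slice smoothness `GaussianGap.contDiff_lerayOrbit_slice_of_typeI`).
[cite: PineauVicol2026, Lemma 8.1 (8.3) (p. 28); Lemma 7.1 (7.2) (p. 24)] -/
theorem typeI_corotatingProfile_decay83 (N : ℕ) (M : ℝ) :
    ∃ K : ℝ, 0 ≤ K ∧ ∀ (α : ℝ) (V : ℝ → EuclideanSpace ℝ (Fin 3) → EuclideanSpace ℝ (Fin 3))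
      (U : EuclideanSpace ℝ (Fin 3) → ℝ → EuclideanSpace ℝ (Fin 3)),
      IsTypeIAncientMild M V → HasTypeIDecay M V →
      (∀ y s, U y s = rotZ (-(α * s)) (lerayOrbit V s (rotZ (α * s) y))) →
      ∀ (s : ℝ), ∀ j ≤ N, ∀ (y : EuclideanSpace ℝ (Fin 3)),
        (1 + ‖y‖) ^ (j + 1) * ‖iteratedFDeriv ℝ j (fun z => U z s) y‖ ≤ K := by
  obtain ⟨K, hK0, hK⟩ :=
    IsTypeIAncientMild.exists_forall_le_pow_mul_norm_iteratedFDeriv_lerayOrbit_of_hasTypeIDecay N M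
  refine ⟨K, hK0, fun α V U hT hdec hUys s j hj y => ?_⟩
  have e : (fun z => U z s) = fun z => rotZ (-(α * s)) (lerayOrbit V s (rotZ (α * s) z)) :=
    funext fun z => hUys z s
  have hj' : ContDiff ℝ j (lerayOrbit V s) :=
    GaussianGap.contDiff_lerayOrbit_slice_of_typeI hT s (by exact_mod_cast (le_top : (j : ℕ∞) ≤ ⊤))
  rw [e, norm_iteratedFDeriv_rotZ_conj hj', ← norm_rotZ (α * s) y]
  exact hK hT hdec s j hj _

/-! ### The transported pressure is the Calderón–Zygmund pressure of the co-rotating slice -/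

/-- **R-108 (iv): `P(·, s) = Q[U(·, s)]` exactly.** For a Type-I ancient mild `V` with the
space–time Type-I bound, the transported Calderón–Zygmund pressure
`P(y, s) = e^{−s} Q[V(−e^{−s})](e^{−s/2} R_{αs} y)` of the hypotheses package equals the
Calderón–Zygmund pressure `Q[U(·, s)](y)` of the co-rotating slice itself: the Navier–Stokes scaling
of `Q` (`exp_mul_pressurePotential_eq`: `= Q[lerayOrbit V s](R_{αs} y)`) and the `O(3)`-covariance
`Q[L⁻¹ v L](x) = Q[v](L x)` (`TwistNormalForm.pressurePotential_conj_symm`, `L = R_{αs}`). [folklore] -/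
theorem typeI_corotatingProfile_pressure_eq {M α : ℝ}
    {V : ℝ → EuclideanSpace ℝ (Fin 3) → EuclideanSpace ℝ (Fin 3)}
    (hT : IsTypeIAncientMild M V) (hVdec : HasTypeIDecay M V)
    {U : EuclideanSpace ℝ (Fin 3) → ℝ → EuclideanSpace ℝ (Fin 3)}
    {P : EuclideanSpace ℝ (Fin 3) → ℝ → ℝ}
    (hUys : ∀ y s, U y s = rotZ (-(α * s)) (lerayOrbit V s (rotZ (α * s) y)))
    (hPys : ∀ y s, P y s = Real.exp (-s) * pressurePotential (V (-Real.exp (-s)))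
      (Real.exp (-s / 2) • rotZ (α * s) y)) (s : ℝ) :
    (fun z => P z s) = pressurePotential (fun z => U z s) := by
  have ht : -Real.exp (-s) < 0 := neg_neg_of_pos (Real.exp_pos _)
  have hV2 : ContDiff ℝ 2 (V (-Real.exp (-s))) :=
    (hT.contDiff_slice ht).of_le (by norm_cast)
  have e : (fun z => U z s) =
      fun z => (rotZLIE (α * s)).symm (lerayOrbit V s (rotZLIE (α * s) z)) :=
    funext fun z => by rw [hUys, rotZLIE_symm_apply, rotZLIE_apply]
  funext z
  rw [hPys, exp_mul_pressurePotential_eq hVdec s hV2, e, pressurePotential_conj_symm, rotZLIE_apply]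

/-! ### (8.2) on the class -/

/-- **Pineau–Vicol (8.2) at the CLASS level.** For every Type-I constant `M` there is
`Cs = Cs(M) ≥ 0` such that for every `1 < c`, every `θ`, and every Type-I ancient mild `V` (KNSS
gauge, constant `M`) with the space–time Type-I bound `HasTypeIDecay M V` and the rotated-DSS
structure `IsRotatedDSS c (rotZLIE (−θ)) V`, the co-rotating similarity profile
`U(y,s) = R_{−αs}(lerayOrbit V s)(R_{αs} y)`, `α = θ/(2 log c)`, obeys on EVERY slice
`|∂ₛU(y,s)| ≤ Cs (2 log c) (1+|α|)² / (1+|y|)` and `|∇_y ∂ₛU(y,s)| ≤ Cs (2 log c) (1+|α|)² / (1+|y|)²`.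
Assembly: joint `C^∞` and exact `2 log c`-periodicity and the co-rotating profile equation from
`typeI_rdss_corotatingProfile_hypotheses`; its pressure is `Q[U(·,s)]`
(`typeI_corotatingProfile_pressure_eq`); (8.3) with one constant at the orders `≤ 7`
(`typeI_corotatingProfile_decay83`); then the Literature theorem for abstract jointly smooth periodic
families in the summit-side convention (`PineauVicol2026.exists_norm_timeDeriv_le_of_periodic`,
`exists_norm_fderiv_timeDeriv_le_of_periodic`). The honest content is
the EFFECTIVENESS of `Cs` (it depends on `M` only); no exclusion is claimed.
[cite: PineauVicol2026, Lemma 8.1 (8.2) (p. 28)] -/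
theorem typeI_rdss_corotatingProfile_timeDeriv_decay (M : ℝ) :
    ∃ Cs : ℝ, 0 ≤ Cs ∧ ∀ (c θ : ℝ) (V : ℝ → EuclideanSpace ℝ (Fin 3) → EuclideanSpace ℝ (Fin 3))
      (U : EuclideanSpace ℝ (Fin 3) → ℝ → EuclideanSpace ℝ (Fin 3)), 1 < c →
      IsTypeIAncientMild M V → IsRotatedDSS c (rotZLIE (-θ)) V → HasTypeIDecay M V →
      (∀ y s, U y s = rotZ (-(θ / (2 * Real.log c) * s))
        (lerayOrbit V s (rotZ (θ / (2 * Real.log c) * s) y))) →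
      ∀ (s : ℝ) (y : EuclideanSpace ℝ (Fin 3)),
        ‖fderiv ℝ (fun σ => U y σ) s 1‖ ≤
            Cs * (2 * Real.log c) * (1 + |θ / (2 * Real.log c)|) ^ 2 / (1 + ‖y‖) ∧
          ‖fderiv ℝ (fun z => fderiv ℝ (fun σ => U z σ) s 1) y‖ ≤
            Cs * (2 * Real.log c) * (1 + |θ / (2 * Real.log c)|) ^ 2 / (1 + ‖y‖) ^ 2 := by
  obtain ⟨K, hK0, hK⟩ := typeI_corotatingProfile_decay83 7 M
  obtain ⟨C₁, hC₁⟩ := exists_norm_timeDeriv_le_of_periodic K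
  obtain ⟨C₂, hC₂⟩ := exists_norm_fderiv_timeDeriv_le_of_periodic K
  refine ⟨max (max C₁ C₂) 0, le_max_right _ _, ?_⟩
  intro c θ V U hc hT hR hVdec hUys s y
  -- the hypotheses package, with the transported Calderón–Zygmund pressure
  have hPys : ∀ (y : EuclideanSpace ℝ (Fin 3)) (s : ℝ),
      (fun (y : EuclideanSpace ℝ (Fin 3)) (s : ℝ) => Real.exp (-s) *
        pressurePotential (V (-Real.exp (-s)))
          (Real.exp (-s / 2) • rotZ (θ / (2 * Real.log c) * s) y)) y s =
      Real.exp (-s) * pressurePotential (V (-Real.exp (-s)))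
        (Real.exp (-s / 2) • rotZ (θ / (2 * Real.log c) * s) y) := fun y s => rfl
  obtain ⟨hUj, -, hper, heq, -, -, -, -⟩ :=
    typeI_rdss_corotatingProfile_hypotheses hc hT hR hVdec hUys hPys
  have hPQ := typeI_corotatingProfile_pressure_eq hT hVdec hUys hPys
  set α : ℝ := θ / (2 * Real.log c) with hα
  set S : ℝ := 2 * Real.log c with hS_def
  have hS : 0 < S := by have := Real.log_pos hc; positivity
  -- (8.3) with one constant, orders `≤ 7` (and `≤ 6`)
  have h83 : ∀ σ, ∀ j ≤ 7, ∀ (z : EuclideanSpace ℝ (Fin 3)),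
      (1 + ‖z‖) ^ (j + 1) * ‖iteratedFDeriv ℝ j (fun w => U w σ) z‖ ≤ K :=
    fun σ j hj z => hK α V U hT hVdec hUys σ j hj z
  have h83' : ∀ σ, ∀ j ≤ 6, ∀ (z : EuclideanSpace ℝ (Fin 3)),
      (1 + ‖z‖) ^ (j + 1) * ‖iteratedFDeriv ℝ j (fun w => U w σ) z‖ ≤ K :=
    fun σ j hj z => h83 σ j (hj.trans (by norm_num)) z
  -- the slice equations (1.14a) with `P = Q[U(σ)]`
  have heq' : ∀ σ (z : EuclideanSpace ℝ (Fin 3)), fderiv ℝ (fun τ => U z τ) σ 1 +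
      α • (rotGen (U z σ) - fderiv ℝ (fun w => U w σ) z (rotGen z)) + (1 / 2 : ℝ) • U z σ +
        (1 / 2 : ℝ) • fderiv ℝ (fun w => U w σ) z z - (Δ (fun w => U w σ)) z +
        convect (fun w => U w σ) (fun w => U w σ) z +
        gradient (pressurePotential (fun w => U w σ)) z = 0 := by
    intro σ z
    have e := heq σ z
    rw [hPQ σ] at e
    exact e
  have h1 := hC₁ U α S hS hUj (fun z σ => hper z σ) h83' heq' s y
  have h2 := hC₂ U α S hS hUj (fun z σ => hper z σ) h83 heq' s y
  have hden₁ : 0 ≤ S * (1 + |α|) ^ 2 / (1 + ‖y‖) := by positivity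
  have hden₂ : 0 ≤ S * (1 + |α|) ^ 2 / (1 + ‖y‖) ^ 2 := by positivity
  have hle₁ : C₁ ≤ max (max C₁ C₂) 0 := (le_max_left _ _).trans (le_max_left _ _)
  have hle₂ : C₂ ≤ max (max C₁ C₂) 0 := (le_max_right _ _).trans (le_max_left _ _)
  constructor
  · refine h1.trans ?_
    calc C₁ * S * (1 + |α|) ^ 2 / (1 + ‖y‖) = C₁ * (S * (1 + |α|) ^ 2 / (1 + ‖y‖)) := by ring
      _ ≤ max (max C₁ C₂) 0 * (S * (1 + |α|) ^ 2 / (1 + ‖y‖)) :=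
          mul_le_mul_of_nonneg_right hle₁ hden₁
      _ = max (max C₁ C₂) 0 * S * (1 + |α|) ^ 2 / (1 + ‖y‖) := by ring
  · refine h2.trans ?_
    calc C₂ * S * (1 + |α|) ^ 2 / (1 + ‖y‖) ^ 2 = C₂ * (S * (1 + |α|) ^ 2 / (1 + ‖y‖) ^ 2) := by
          ring
      _ ≤ max (max C₁ C₂) 0 * (S * (1 + |α|) ^ 2 / (1 + ‖y‖) ^ 2) :=
          mul_le_mul_of_nonneg_right hle₂ hden₂
      _ = max (max C₁ C₂) 0 * S * (1 + |α|) ^ 2 / (1 + ‖y‖) ^ 2 := by ring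

/-! ### Proposition 8.3 (8.6) at the class level -/

/-- `1 + a² ≤ (1 + a)²` for `a ≥ 0`. [folklore] -/
private theorem one_add_sq_le_sq_one_add {a : ℝ} (ha : 0 ≤ a) : 1 + a ^ 2 ≤ (1 + a) ^ 2 := by
  nlinarith

/-- `1 + a³ ≤ (1 + a)³` for `a ≥ 0`. [folklore] -/
private theorem one_add_cube_le_cube_one_add {a : ℝ} (ha : 0 ≤ a) :
    1 + a ^ 3 ≤ (1 + a) ^ 3 := by
  nlinarith [sq_nonneg a, mul_nonneg ha (sq_nonneg a)]

/-- `‖D(DU)(y)‖ = ‖D²U(y)‖` (Mathlib's curried/uncurried isometry). [folklore] -/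
private theorem norm_fderiv_fderiv_eq_norm_iteratedFDeriv_two
    (f : EuclideanSpace ℝ (Fin 3) → EuclideanSpace ℝ (Fin 3)) (y : EuclideanSpace ℝ (Fin 3)) :
    ‖fderiv ℝ (fderiv ℝ f) y‖ = ‖iteratedFDeriv ℝ 2 f y‖ := by
  rw [← norm_iteratedFDeriv_one (fderiv ℝ f), norm_iteratedFDeriv_fderiv]

/-- **Pineau–Vicol Proposition 8.3 (8.6) at the CLASS level.** For every Type-I constant `M` and
every `ε > 0` there are `A = A(M, ε) ≥ 1` and `δ = δ(M, ε) > 0` such that: for every `1 < c`, `θ`,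
and every Type-I ancient mild `V` (KNSS gauge, constant `M`) with `HasTypeIDecay M V` and
`IsRotatedDSS c (rotZLIE (−θ)) V`, writing `α = θ/(2 log c)` and `U` for the co-rotating similarity
profile, IF `A ≤ |α|` and `(2 log c)(1+|α|)² ≤ δ` THEN on every slice
`|α| (∫ G |JU − D_yU[Jy]|²)^{1/2} ≤ ε` (`G = gaussWeight`, `J = rotGen`). This is the tree's
`pineauVicol_prop_8_3''` (hypotheses on the slice profile only) with ALL its hypotheses discharged
on the class: `C⁴` slices and incompressibility (hypotheses package), (1.9)/(2.1) with the one
constant of `typeI_corotatingProfile_decay83` (orders `≤ 2`), the slice equation (1.14a) with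
`P = Q[U(·,s)]` (`typeI_corotatingProfile_pressure_eq`) and `F = ∂ₛU(·,s)`, and Lemma 8.1's source
bound (8.2) on `F` with `S = 2 log c` (`typeI_rdss_corotatingProfile_timeDeriv_decay`). A SMALLNESS
statement for the rotation defect at large `|α|`; not an exclusion and not a census word.
[cite: PineauVicol2026, Proposition 8.3 (8.6) (p. 28); Lemma 8.1 (8.2) (p. 28)] -/
theorem typeI_rdss_corotatingProfile_prop_8_3 (M : ℝ) {ε : ℝ} (hε : 0 < ε) :
    ∃ A : ℝ, 1 ≤ A ∧ ∃ δ : ℝ, 0 < δ ∧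
      ∀ (c θ : ℝ) (V : ℝ → EuclideanSpace ℝ (Fin 3) → EuclideanSpace ℝ (Fin 3))
        (U : EuclideanSpace ℝ (Fin 3) → ℝ → EuclideanSpace ℝ (Fin 3)), 1 < c →
        IsTypeIAncientMild M V → IsRotatedDSS c (rotZLIE (-θ)) V → HasTypeIDecay M V →
        (∀ y s, U y s = rotZ (-(θ / (2 * Real.log c) * s))
          (lerayOrbit V s (rotZ (θ / (2 * Real.log c) * s) y))) →
        A ≤ |θ / (2 * Real.log c)| →
        2 * Real.log c * (1 + |θ / (2 * Real.log c)|) ^ 2 ≤ δ →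
        ∀ s : ℝ, |θ / (2 * Real.log c)| *
          Real.sqrt (∫ y, gaussWeight y *
            ‖rotGen (U y s) - fderiv ℝ (fun z => U z s) y (rotGen y)‖ ^ 2) ≤ ε := by
  obtain ⟨K, hK0, hK⟩ := typeI_corotatingProfile_decay83 2 M
  obtain ⟨Cs, -, hCs⟩ := typeI_rdss_corotatingProfile_timeDeriv_decay M
  obtain ⟨A, hA1, δ, hδ, h⟩ := pineauVicol_prop_8_3'' K K K Cs hε
  refine ⟨A, hA1, δ, hδ, ?_⟩
  intro c θ V U hc hT hR hVdec hUys hAα hsmall s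
  -- the hypotheses package, with the transported Calderón–Zygmund pressure
  have hPys : ∀ (y : EuclideanSpace ℝ (Fin 3)) (s : ℝ),
      (fun (y : EuclideanSpace ℝ (Fin 3)) (s : ℝ) => Real.exp (-s) *
        pressurePotential (V (-Real.exp (-s)))
          (Real.exp (-s / 2) • rotZ (θ / (2 * Real.log c) * s) y)) y s =
      Real.exp (-s) * pressurePotential (V (-Real.exp (-s)))
        (Real.exp (-s / 2) • rotZ (θ / (2 * Real.log c) * s) y) := fun y s => rfl
  obtain ⟨hUj, -, -, heq, hdiv, -, -, -⟩ :=
    typeI_rdss_corotatingProfile_hypotheses hc hT hR hVdec hUys hPys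
  have hPQ := typeI_corotatingProfile_pressure_eq hT hVdec hUys hPys
  have h82 := hCs c θ V U hc hT hR hVdec hUys
  have h83 : ∀ j ≤ 2, ∀ (z : EuclideanSpace ℝ (Fin 3)),
      (1 + ‖z‖) ^ (j + 1) * ‖iteratedFDeriv ℝ j (fun w => U w s) z‖ ≤ K :=
    fun j hj z => hK _ V U hT hVdec hUys s j hj z
  set α : ℝ := θ / (2 * Real.log c) with hα
  set S : ℝ := 2 * Real.log c with hS_def
  have hS0 : 0 ≤ S := by have := Real.log_pos hc; positivity
  -- regularity of the slice and of the source `F = ∂ₛU(·, s)`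
  have hUsl : ContDiff ℝ 4 (fun z => U z s) := by
    have h' : ContDiff ℝ ∞ (fun z => U z s) := hUj.comp (contDiff_id.prodMk contDiff_const)
    exact h'.of_le (by norm_cast)
  have hUj1 : ContDiff ℝ 1 (uncurry fun (z : EuclideanSpace ℝ (Fin 3)) (σ : ℝ) => U z σ) :=
    hUj.of_le (by norm_cast)
  have hF : Continuous fun z : EuclideanSpace ℝ (Fin 3) => fderiv ℝ (fun σ => U z σ) s 1 :=
    (hUj1.fderiv_apply contDiff_const contDiff_const (zero_add 1).le).continuous
  -- (1.9), (2.1) for the slice from (8.3) at the orders `0, 1, 2`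
  have h1y : ∀ z : EuclideanSpace ℝ (Fin 3), 0 < 1 + ‖z‖ := fun z => by positivity
  have h19 : ∀ z : EuclideanSpace ℝ (Fin 3), ‖U z s‖ ≤ K / (1 + ‖z‖) := by
    intro z
    have h0 := h83 0 (by norm_num) z
    rw [zero_add, pow_one, norm_iteratedFDeriv_zero] at h0
    exact (le_div_iff₀' (h1y z)).2 h0
  have h21 : ∀ z : EuclideanSpace ℝ (Fin 3),
      ‖fderiv ℝ (fun w => U w s) z‖ ≤ K / (1 + ‖z‖ ^ 2) := by
    intro z
    have h0 := h83 1 (by norm_num) z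
    rw [norm_iteratedFDeriv_one] at h0
    have h0' : ‖fderiv ℝ (fun w => U w s) z‖ ≤ K / (1 + ‖z‖) ^ (1 + 1) :=
      (le_div_iff₀' (by positivity)).2 h0
    refine h0'.trans (div_le_div_of_nonneg_left hK0 (by positivity) ?_)
    rw [show (1 + 1 : ℕ) = 2 from rfl]
    exact one_add_sq_le_sq_one_add (norm_nonneg z)
  have h21' : ∀ z : EuclideanSpace ℝ (Fin 3),
      ‖fderiv ℝ (fderiv ℝ (fun w => U w s)) z‖ ≤ K / (1 + ‖z‖ ^ 3) := by
    intro z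
    have h0 := h83 2 (by norm_num) z
    rw [← norm_fderiv_fderiv_eq_norm_iteratedFDeriv_two] at h0
    have h0' : ‖fderiv ℝ (fderiv ℝ (fun w => U w s)) z‖ ≤ K / (1 + ‖z‖) ^ (2 + 1) :=
      (le_div_iff₀' (by positivity)).2 h0
    refine h0'.trans (div_le_div_of_nonneg_left hK0 (by positivity) ?_)
    rw [show (2 + 1 : ℕ) = 3 from rfl]
    exact one_add_cube_le_cube_one_add (norm_nonneg z)
  -- the slice equation (1.14a) with `P = Q[U(·,s)]` and `F = ∂ₛU(·,s)` last
  have heq' : ∀ z : EuclideanSpace ℝ (Fin 3),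
      α • (rotGen (U z s) - fderiv ℝ (fun w => U w s) z (rotGen z)) + (1 / 2 : ℝ) • U z s +
        (1 / 2 : ℝ) • fderiv ℝ (fun w => U w s) z z - (Δ (fun w => U w s)) z +
        convect (fun w => U w s) (fun w => U w s) z +
        gradient (pressurePotential (fun w => U w s)) z + fderiv ℝ (fun σ => U z σ) s 1 = 0 := by
    intro z
    have e := heq s z
    rw [hPQ s] at e
    rw [← e]
    abel
  exact h (fun z => U z s) (fun z => fderiv ℝ (fun σ => U z σ) s 1) α S hUsl (hdiv s) h19 h21
    h21' hF hS0 (fun z => (h82 s z).1) heq' hAα hsmall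

end Summit.NavierStokesRegularity.NavierStokesRegularity.Theorems.GaussianHeadPressure

end
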